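import Literature.Probability.RandomPlanarGeometry.SAWPulledLargeForceExpansionZd
import HarnessLib

/-!
# The pulled self-avoiding walk on `ℤ^{d+1}` at large force: THE FIRST TWO COEFFICIENTS `c^{(d)}_1 = 2d`, `c^{(d)}_2 = −2d`,
# and the expansion to every order with remainder — `e^{λ_B(y)} = y + 2d − 2d/y + O(1/y²)` in every dimension

Topic `Literature/Probability/RandomPlanarGeometry` (uses `SAWPulledLargeForceExpansionZd.lean`: the convergent large-force expansion
`e^{λ_B(y)} = Σ_k c^{(d)}_k y^{1−k}` on `ℤ^{d+1}` with integer coefficients `c^{(d)}_k = Zd.largeForceCoeffZd d k = CostSeries.e (costCoeffZd d) k`,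
`c^{(d)}_0 = 1`, and the coefficient bound `CostSeries.abs_e_le`).

Printed sources. E. J. Janse van Rensburg, S. G. Whittington, J. Phys. A 46 (2013) 435003, §3.2 Theorem 8 (arXiv v4 p. 11): the free energy
of the pulled walk is `log y` to first order (square lattice). The constant term (`2d`, the number of transverse directions of `ℤ^{d+1}`), the
`1/y` term (`−2d`) and the remainder estimates below are not in print (lane «pcv-sawmu»).

## Contents (all PROVED, standard axioms only; no data, no certificates)

* generic (`namespace CostSeries`, any cost data `N`): `A_one`, ★ `e_one` (`e_1 = P_1(1) = Σ_n N_{1,n}`), `coeff_one_sub_X_mul_C_pow`,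
  ★ `e_two` (`e_2 = P_2(1) + P_1(1)² − P_1(1)·P_1'(1)`).
* combinatorics on `ℤ^{d+1}` (`namespace Zd`): the cost-one irreducible bridges are exactly the `2d` two-step walks `(0, e₀, e₀ ± e_j)`
  (`twoStep…`, `filter_costZd_one_two_eq_image`) and the cost-two ones are exactly the `2d(2d−1)` three-step walks `(0, e₀, e₀+v, e₀+v+w)`,
  `v, w` transverse, `w ≠ −v` (`threeStep…`, `filter_costZd_two_three_eq_image`; NO cost-two irreducible bridge of length four:
  `costCoeffZd_two_four`, by renewal times read off the heights `0,1,h₂,h₃,2`); hence ★ `costCoeffZd_one_two = 2d`, `costCoeffZd_one_of_ne_two`,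
  ★ `costCoeffZd_two` (`2d(2d−1)` at `n = 3`, else `0`); step lemmas `exists_twoStepV_of_adj`, `eq_add_e0_of_adj`, `eq_sub_e0_of_adj`,
  `apply_one_eq_e0_of_mem_bridges`.
* ★★ **`largeForceCoeffZd_at_one : largeForceCoeffZd d 1 = 2d`**, ★★ **`largeForceCoeffZd_at_two : largeForceCoeffZd d 2 = −2d`**;
  for `ℤ²`: `largeForceCoeff_one_eq_two`, `largeForceCoeff_two_eq_neg_two` (the certified values `c₁ = 2`, `c₂ = −2`, now certificate-free).
* ★★ **`exp_pulledBridgeFreeEnergy_expansion_zd (d K)`**: `|e^{λ_B(y)} − Σ_{k≤K} c^{(d)}_k y^{1−k}| ≤ C_K / y^K` for `y ≥ y₁` — the expansion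
  to EVERY order with remainder, every dimension; corollaries `exp_pulledBridgeFreeEnergy_first_order_zd` (`y + 2d + O(1/y)`),
  ★★ `exp_pulledBridgeFreeEnergy_second_order_zd` (`y + 2d − 2d/y + O(1/y²)`), `tendsto_exp_pulledBridgeFreeEnergy_sub_zd` (`e^{λ_B(y)} − y → 2d`).

## Sequels and the support of the cost data

`SAWPulledLargeForceExpansionZdThirdOrder.lean` (`c^{(d)}_3 = 2d(2d+1)`, generic `CostSeries.e_three`, analyticity of `e^{λ_B(y)}/y` in `1/y`
at `y = ∞` in every dimension), `SAWPulledLargeForceExpansionZdHeights.lean` (height-profile tools: monotone profiles are reducible; the step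
pairs `+e₀,−e₀` / `−e₀,+e₀` revisit a site), `SAWPulledLargeForceExpansionZdFourthOrder.lean` (`c^{(d)}_4 = −4d²(2d+3)`, the cost-four census,
the convolution identity `Σ_{i+j=k} a_i e_j = 0` between the `u`-coefficients and the inverse coefficients). The support bound of the parent
file, `costCoeffZd_eq_zero_of_lt` (`N_{c,n} = 0` unless `2n ≤ 3c + 2`, from the three-crossings lemma `three_mul_span_le`), is sharpened by
`SAWIrreducibleBridgeThreeSpan.three_mul_span_le_of_two_le` (Madras–Slade §4.2, p. 94: an irreducible bridge of span `A ≥ 2` has at least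
`3A` steps) to: `N_{c,n} = 0` unless `n = c + 1` or `2n ≤ 3c` — which re-derives `costCoeffZd_two_four` below without the height case analysis.

Provenance: lane «pcv-sawmu», a-p3 g15 (2026-08-24); sequel paragraph a-p3 g16.
-/

noncomputable section

open Finset Filter Topology
open scoped BigOperators
open Literature.Probability.LatticeModels
open Literature.Probability.RandomPlanarGeometry.SAW

namespace Literature.Probability.RandomPlanarGeometry.SAW.Zd

namespace CostSeries

variable (N : ℕ → ℕ → ℕ)

/-- `A_1 = 1 − X · P_1(1)` (since `A_0 = 1`). [cite: JansevanRensburgWhittington2013, §3.2 Theorem 8 (arXiv v4 p. 11)] -/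
theorem A_one : A N 1 = 1 - Polynomial.X * Polynomial.C (∑ n ∈ Finset.range 4, (N 1 n : ℤ)) := by
  show (1 : Polynomial ℤ) - ∑ j ∈ Finset.range (0 + 1), Polynomial.X ^ (j + 1) * (Pz N (j + 1)).comp (A N 0) = _
  have h0 : A N 0 = 1 := rfl
  rw [zero_add, Finset.sum_range_one, zero_add, pow_one, h0, Polynomial.comp_one]
  congr 3
  simp [Pz, Polynomial.eval_finsetSum]

/-- ★ **`e_1 = P_1(1) = Σ_n N_{1,n}`**: the first inverse coefficient counts the cost-one irreducible objects.
[cite: JansevanRensburgWhittington2013, §3.2 Theorem 8 (arXiv v4 p. 11)] -/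
theorem e_one : e N 1 = ∑ n ∈ Finset.range 4, (N 1 n : ℤ) := by
  have hE : E N 1 = 1 + Polynomial.X * Polynomial.C (∑ n ∈ Finset.range 4, (N 1 n : ℤ)) := by
    show ∑ j ∈ Finset.range (1 + 1), (1 - A N 1) ^ j = _
    rw [Finset.sum_range_succ, Finset.sum_range_one, pow_zero, pow_one, A_one, sub_sub_cancel]
  show (E N 1).coeff 1 = _
  rw [hE, Polynomial.coeff_add, Polynomial.coeff_one, Polynomial.coeff_X_mul, Polynomial.coeff_C_zero]
  simp

/-- Coefficients `0` and `1` of `(1 − cX)^n`: `1` and `−nc`. [cite: JansevanRensburgWhittington2013, §3.2 Theorem 8 (arXiv v4 p. 11)] -/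
theorem coeff_one_sub_X_mul_C_pow (c : ℤ) (n : ℕ) :
    ((1 - Polynomial.X * Polynomial.C c) ^ n).coeff 0 = 1 ∧
      ((1 - Polynomial.X * Polynomial.C c) ^ n).coeff 1 = -((n : ℤ) * c) := by
  induction n with
  | zero => simp [Polynomial.coeff_one]
  | succ n ih =>
    have h0 : ((1 : Polynomial ℤ) - Polynomial.X * Polynomial.C c).coeff 0 = 1 := by simp
    have h1 : ((1 : Polynomial ℤ) - Polynomial.X * Polynomial.C c).coeff 1 = -c := by simp [Polynomial.coeff_one]
    rw [pow_succ]
    constructor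
    · rw [Polynomial.mul_coeff_zero, ih.1, h0, mul_one]
    · rw [Polynomial.coeff_mul, Finset.Nat.sum_antidiagonal_eq_sum_range_succ_mk, Finset.sum_range_succ,
        Finset.sum_range_one, Nat.sub_zero, Nat.sub_self, ih.1, ih.2, h0, h1]
      push_cast; ring

/-- ★ **`e_2 = P_2(1) + P_1(1)² − P_1(1)·P_1'(1)`** (generic second inverse coefficient).
[cite: JansevanRensburgWhittington2013, §3.2 Theorem 8 (arXiv v4 p. 11)] -/
theorem e_two : e N 2 = (∑ n ∈ Finset.range 6, (N 2 n : ℤ)) + (∑ n ∈ Finset.range 4, (N 1 n : ℤ)) ^ 2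
    - (∑ n ∈ Finset.range 4, (N 1 n : ℤ)) * (∑ n ∈ Finset.range 4, ((n : ℤ) * N 1 n)) := by
  set c := ∑ n ∈ Finset.range 4, (N 1 n : ℤ) with hc
  have hA1 : A N 1 = 1 - Polynomial.X * Polynomial.C c := A_one N
  set q1 := (Pz N 1).comp (A N 1) with hq1
  set q2 := (Pz N 2).comp (A N 1) with hq2
  have hA1eval : (A N 1).eval 0 = 1 := by rw [hA1]; simp
  have hq1c0 : q1.coeff 0 = c := by
    rw [Polynomial.coeff_zero_eq_eval_zero, hq1, Polynomial.eval_comp, hA1eval]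
    simp [Pz, Polynomial.eval_finsetSum, hc]
  have hq2c0 : q2.coeff 0 = ∑ n ∈ Finset.range 6, (N 2 n : ℤ) := by
    rw [Polynomial.coeff_zero_eq_eval_zero, hq2, Polynomial.eval_comp, hA1eval]
    simp [Pz, Polynomial.eval_finsetSum]
  have hq1c1 : q1.coeff 1 = -(c * ∑ n ∈ Finset.range 4, ((n : ℤ) * N 1 n)) := by
    have hx : q1 = ∑ n ∈ Finset.range (2 * 1 + 2), Polynomial.C (N 1 n : ℤ) * (A N 1) ^ n := by
      rw [hq1, Pz, Polynomial.sum_comp]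
      refine Finset.sum_congr rfl fun n _ => ?_
      rw [Polynomial.mul_comp, Polynomial.C_comp, Polynomial.X_pow_comp]
    rw [hx, Polynomial.finsetSum_coeff, Finset.mul_sum, ← Finset.sum_neg_distrib]
    refine Finset.sum_congr rfl fun n _ => ?_
    rw [Polynomial.coeff_C_mul, hA1, (coeff_one_sub_X_mul_C_pow c n).2]
    ring
  have hA2 : 1 - A N 2 = Polynomial.X * (q1 + Polynomial.X * q2) := by
    show 1 - (1 - ∑ j ∈ Finset.range (1 + 1), Polynomial.X ^ (j + 1) * (Pz N (j + 1)).comp (A N 1)) = _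
    rw [sub_sub_cancel, Finset.sum_range_succ, Finset.sum_range_one]
    ring
  have hE : E N 2 = 1 + (1 - A N 2) + (1 - A N 2) ^ 2 := by
    show ∑ j ∈ Finset.range (2 + 1), (1 - A N 2) ^ j = _
    simp [Finset.sum_range_succ]
  show (E N 2).coeff 2 = _
  rw [hE, hA2]
  set r := q1 + Polynomial.X * q2 with hr
  have hr0 : r.coeff 0 = c := by rw [hr, Polynomial.coeff_add, Polynomial.coeff_X_mul_zero, hq1c0, add_zero]
  have hr1 : r.coeff 1 = q1.coeff 1 + q2.coeff 0 := by rw [hr, Polynomial.coeff_add, Polynomial.coeff_X_mul]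
  have h2 : ((1 : Polynomial ℤ) + Polynomial.X * r + (Polynomial.X * r) ^ 2).coeff 2 = r.coeff 1 + r.coeff 0 ^ 2 := by
    rw [Polynomial.coeff_add, Polynomial.coeff_add, Polynomial.coeff_one, mul_pow, Polynomial.coeff_X_pow_mul, pow_two,
      Polynomial.mul_coeff_zero, show (2 : ℕ) = 1 + 1 from rfl, Polynomial.coeff_X_mul]
    simp [pow_two]
  rw [h2, hr1, hr0, hq1c1, hq2c0]
  ring

end CostSeries

/-! ### The cost-one irreducible bridges of `ℤ^{d+1}`: `(0, e₀, e₀ ± e_j)` -/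

/-- The two-step walk `(0, e₀, e₀ + σ e_{j+1})`, `σ = ±1`, indexed by `s = (j, σ) ∈ Fin d × Bool`. [cite: MadrasSlade1993, Definition 1.2.4] -/
def twoStep (d : ℕ) (s : Fin d × Bool) : ℕ → Site (d + 1) := fun i =>
  if i = 0 then 0 else if i = 1 then Pi.single 0 1 else Pi.single 0 1 + Pi.single s.1.succ (if s.2 then 1 else -1)

/-- The transverse step `σ e_{j+1}`. [cite: MadrasSlade1993, Definition 1.2.4] -/
def twoStepV (d : ℕ) (s : Fin d × Bool) : Site (d + 1) := Pi.single s.1.succ (if s.2 then 1 else -1)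

/-- Value at `0`. [cite: MadrasSlade1993, Definition 1.2.4] -/
@[simp] theorem twoStep_zero (d : ℕ) (s : Fin d × Bool) : twoStep d s 0 = 0 := by simp [twoStep]

/-- Value at `1`. [cite: MadrasSlade1993, Definition 1.2.4] -/
@[simp] theorem twoStep_one (d : ℕ) (s : Fin d × Bool) : twoStep d s 1 = Pi.single 0 1 := by simp [twoStep]

/-- Value at `i ≥ 2`. [cite: MadrasSlade1993, Definition 1.2.4] -/
theorem twoStep_of_two_le (d : ℕ) (s : Fin d × Bool) {i : ℕ} (hi : 2 ≤ i) :
    twoStep d s i = Pi.single 0 1 + twoStepV d s := by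
  have h0 : i ≠ 0 := by omega
  have h1 : i ≠ 1 := by omega
  simp [twoStep, twoStepV, h0, h1]

/-- The transverse step has no `e₀`-component. [cite: MadrasSlade1993, Definition 1.2.4] -/
@[simp] theorem twoStepV_apply_zero (d : ℕ) (s : Fin d × Bool) : twoStepV d s 0 = 0 := by
  simp [twoStepV]

/-- The transverse step is non-zero. [cite: MadrasSlade1993, Definition 1.2.4] -/
theorem twoStepV_ne_zero (d : ℕ) (s : Fin d × Bool) : twoStepV d s ≠ 0 := by
  intro h
  have := congrFun h s.1.succ
  rcases hb : s.2 with _ | _ <;> simp [twoStepV, hb] at this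

/-- First coordinates along `twoStep`: `0, 1, 1, 1, …`. [cite: MadrasSlade1993, Definition 1.2.4] -/
theorem twoStep_apply_zero (d : ℕ) (s : Fin d × Bool) (i : ℕ) : twoStep d s i 0 = if i = 0 then 0 else 1 := by
  rcases Nat.lt_or_ge i 2 with hi | hi
  · interval_cases i <;> simp
  · rw [twoStep_of_two_le d s hi, if_neg (by omega)]
    simp

/-- `twoStep s` is a two-step self-avoiding walk. [cite: MadrasSlade1993, Definition 1.2.4] -/
theorem twoStep_mem_saws (d : ℕ) (s : Fin d × Bool) : twoStep d s ∈ saws (d + 1) 2 := by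
  refine mem_saws.2 ⟨twoStep_zero d s, fun i hi => ?_, fun i hi => ?_, ?_⟩
  · rw [twoStep_of_two_le d s hi, twoStep_of_two_le d s le_rfl]
  · interval_cases i
    · rw [twoStep_zero, zero_add, twoStep_one, zdGraph_adj_iff]
      exact ⟨0, Or.inl (by simp)⟩
    · rw [twoStep_one, twoStep_of_two_le d s le_rfl, zdGraph_adj_iff]
      refine ⟨s.1.succ, ?_⟩
      rcases hb : s.2 with _ | _
      · right
        rw [twoStepV, hb, add_assoc, ← Pi.single_add]
        simp
      · left
        rw [twoStepV, hb]
        simp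
  · have h01 : twoStep d s 0 ≠ twoStep d s 1 := by
      intro h; have := congrFun h 0; simp at this
    have h02 : twoStep d s 0 ≠ twoStep d s 2 := by
      intro h; have := congrFun h 0
      rw [twoStep_apply_zero, twoStep_apply_zero] at this; simp at this
    have h12 : twoStep d s 1 ≠ twoStep d s 2 := by
      intro h
      rw [twoStep_one, twoStep_of_two_le d s le_rfl] at h
      exact twoStepV_ne_zero d s (by simpa using h.symm)
    intro i hi j hj h
    simp only [Set.mem_setOf_eq] at hi hj
    interval_cases i <;> interval_cases j <;>
      first | rfl | exact absurd h h01 | exact absurd h h02 | exact absurd h h12 | exact absurd h.symm h01 | exact absurd h.symm h02 | exact absurd h.symm h12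

/-- `twoStep s` is a bridge. [cite: MadrasSlade1993, Definition 1.2.4] -/
theorem twoStep_isBridge (d : ℕ) (s : Fin d × Bool) : IsBridge 2 (twoStep d s) := by
  intro i h1 h2
  rw [twoStep_apply_zero, twoStep_apply_zero, twoStep_apply_zero, if_pos rfl, if_neg (by omega), if_neg (by omega)]
  exact ⟨zero_lt_one, le_rfl⟩

/-- `twoStep s` is an irreducible bridge of cost one. [cite: DuminilCopinHammond2013, §2.2] -/
theorem twoStep_mem_filter (d : ℕ) (s : Fin d × Bool) :
    twoStep d s ∈ (irreducibleBridges (d + 1) 2).filter fun ω => costZd d 2 ω = 1 := by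
  refine Finset.mem_filter.2 ⟨mem_irreducibleBridges.2 ⟨mem_bridges.2 ⟨twoStep_mem_saws d s, twoStep_isBridge d s⟩,
    ⟨by norm_num, twoStep_isBridge d s, fun k hk1 hk2 hren => ?_⟩⟩, ?_⟩
  · obtain rfl : k = 1 := by omega
    have h := (hren.2.2 1 le_rfl le_rfl).1
    simp only [add_zero, Nat.reduceAdd, twoStep_apply_zero] at h
    simp at h
  · simp [costZd, twoStep_apply_zero]

/-- Every cost-one irreducible bridge of length two is a `twoStep`. [cite: MadrasSlade1993, Definition 1.2.4] -/
theorem eq_twoStep_of_mem (d : ℕ) {ω : ℕ → Site (d + 1)}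
    (hω : ω ∈ (irreducibleBridges (d + 1) 2).filter fun ω => costZd d 2 ω = 1) : ∃ s, ω = twoStep d s := by
  obtain ⟨hirr, hcost⟩ := Finset.mem_filter.1 hω
  obtain ⟨hbr, -⟩ := mem_irreducibleBridges.1 hirr
  obtain ⟨hωs, hb⟩ := mem_bridges.1 hbr
  obtain ⟨h0, hend, hadj, -⟩ := mem_saws.1 hωs
  have h10 : 0 < ω 1 0 := by have := (hb 1 le_rfl (by norm_num)).1; rwa [h0] at this
  have h20 : 0 < ω 2 0 := by have := (hb 2 (by norm_num) le_rfl).1; rwa [h0] at this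
  -- the first step is `+e₀`
  have hω1 : ω 1 = Pi.single 0 1 := by
    have ha := hadj 0 (by norm_num)
    rw [zero_add, h0, zdGraph_adj_iff] at ha
    obtain ⟨i, hi | hi⟩ := ha
    · rw [zero_add] at hi
      have hc := congrFun hi 0
      by_cases hi0 : i = 0
      · subst hi0; exact hi
      · rw [Pi.single_eq_of_ne (Ne.symm hi0)] at hc
        rw [hc] at h10
        exact absurd h10 (lt_irrefl 0)
    · have hc := congrFun hi 0
      simp only [Pi.zero_apply, Pi.add_apply] at hc
      by_cases hi0 : i = 0
      · subst hi0
        rw [Pi.single_eq_same] at hc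
        omega
      · rw [Pi.single_eq_of_ne (Ne.symm hi0)] at hc
        omega
  -- the end height is `1` (cost one)
  have h2eq : ω 2 0 = 1 := by
    have hc : costZd d 2 ω = 1 := hcost
    simp only [costZd] at hc
    have : (ω 2 0).toNat ≤ 2 := (span_le_and_cost_bound_zd hirr).1
    omega
  -- the second step is transverse
  have ha := hadj 1 (by norm_num)
  rw [hω1, zdGraph_adj_iff] at ha
  obtain ⟨i, hi⟩ := ha
  have hi0 : i ≠ 0 := by
    rintro rfl
    rcases hi with hi | hi
    · have hc := congrFun hi 0
      simp only [Nat.reduceAdd, Pi.add_apply, Pi.single_eq_same] at hc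
      omega
    · have hc := congrFun hi 0
      simp only [Nat.reduceAdd, Pi.add_apply, Pi.single_eq_same] at hc
      omega
  obtain ⟨j, rfl⟩ := Fin.exists_succ_eq.2 hi0
  have hω2 : ∃ b : Bool, ω 2 = Pi.single 0 1 + twoStepV d (j, b) := by
    rcases hi with hi | hi
    · exact ⟨true, by rw [twoStepV]; simpa using hi⟩
    · refine ⟨false, ?_⟩
      rw [twoStepV]
      simp only [Bool.false_eq_true, ↓reduceIte]
      have : ω 2 = Pi.single 0 1 - Pi.single j.succ 1 := by rw [hi]; simp
      rw [this, sub_eq_add_neg, ← Pi.single_neg]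
  obtain ⟨b, hb2⟩ := hω2
  refine ⟨(j, b), funext fun i => ?_⟩
  rcases Nat.lt_or_ge i 2 with hi2 | hi2
  · interval_cases i
    · rw [h0, twoStep_zero]
    · rw [hω1, twoStep_one]
  · rw [hend i hi2, hb2, twoStep_of_two_le d _ hi2]

/-- `twoStep` is injective. [cite: MadrasSlade1993, Definition 1.2.4] -/
theorem twoStep_injective (d : ℕ) : Function.Injective (twoStep d) := by
  rintro ⟨j, b⟩ ⟨j', b'⟩ h
  have h2 := congrFun h 2
  rw [twoStep_of_two_le d _ le_rfl, twoStep_of_two_le d _ le_rfl, add_right_inj, twoStepV, twoStepV] at h2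
  have hj : j = j' := by
    by_contra hne
    have hc := congrFun h2 j.succ
    rw [Pi.single_eq_same, Pi.single_eq_of_ne (fun h' => hne (Fin.succ_injective _ h'))] at hc
    cases b <;> simp at hc
  subst hj
  have hc := congrFun h2 j.succ
  rw [Pi.single_eq_same, Pi.single_eq_same] at hc
  have hb : b = b' := by
    rcases b with _ | _ <;> rcases b' with _ | _ <;> simp_all
  rw [hb]

/-- ★ The cost-one irreducible bridges of length two are exactly the `2d` walks `(0, e₀, e₀ ± e_j)`.
[cite: MadrasSlade1993, §4.2, eq. (4.2.20)–(4.2.22) (p. 94, 2013 reprint)] -/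
theorem filter_costZd_one_two_eq_image (d : ℕ) [DecidableEq (ℕ → Site (d + 1))] :
    ((irreducibleBridges (d + 1) 2).filter fun ω => costZd d 2 ω = 1) = Finset.univ.image (twoStep d) := by
  ext ω
  constructor
  · intro h
    obtain ⟨s, rfl⟩ := eq_twoStep_of_mem d h
    exact Finset.mem_image_of_mem _ (Finset.mem_univ s)
  · intro h
    obtain ⟨s, -, rfl⟩ := Finset.mem_image.1 h
    exact twoStep_mem_filter d s

/-- ★ **`N_{1,2} = 2d`** on `ℤ^{d+1}`. [cite: MadrasSlade1993, §4.2, eq. (4.2.20)–(4.2.22) (p. 94, 2013 reprint)] -/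
theorem costCoeffZd_one_two (d : ℕ) : costCoeffZd d 1 2 = 2 * d := by
  classical
  rw [costCoeffZd, filter_costZd_one_two_eq_image, Finset.card_image_of_injective _ (twoStep_injective d),
    Finset.card_univ, Fintype.card_prod, Fintype.card_fin, Fintype.card_bool, mul_comm]

/-- `N_{1,n} = 0` for `n ≠ 2` (a cost-one irreducible bridge has length two). [cite: MadrasSlade1993, §4.2, eq. (4.2.20)–(4.2.22) (p. 94, 2013 reprint)] -/
theorem costCoeffZd_one_of_ne_two (d : ℕ) {n : ℕ} (hn : n ≠ 2) : costCoeffZd d 1 n = 0 := by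
  rcases Nat.lt_or_ge n 2 with h | h
  · interval_cases n
    · exact costCoeffZd_eq_zero_of_lt' (by norm_num)
    · -- the one-step bridge `+e₀` has cost zero
      rw [costCoeffZd, Finset.card_eq_zero, Finset.filter_eq_empty_iff]
      intro ω hω
      rw [irreducibleBridges_one, bridges_one, Finset.mem_singleton] at hω
      subst hω
      simp [costZd, straightWalk]
  · exact costCoeffZd_eq_zero_of_lt (by omega)

/-- ★★ **THE FIRST-ORDER COEFFICIENT: `c^{(d)}_1 = 2d`** on `ℤ^{d+1}` — the number of transverse directions.
[cite: JansevanRensburgWhittington2013, §3.2 Theorem 8 (arXiv v4 p. 11)] -/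
theorem largeForceCoeffZd_at_one (d : ℕ) : largeForceCoeffZd d 1 = 2 * d := by
  show CostSeries.e (costCoeffZd d) 1 = _
  rw [CostSeries.e_one]
  have h : ∀ n ∈ Finset.range 4, ((costCoeffZd d 1 n : ℕ) : ℤ) = if n = 2 then 2 * (d : ℤ) else 0 := by
    intro n _
    by_cases hn : n = 2
    · subst hn; rw [if_pos rfl, costCoeffZd_one_two]; push_cast; ring
    · rw [if_neg hn, costCoeffZd_one_of_ne_two d hn]; rfl
  rw [Finset.sum_congr rfl h, Finset.sum_ite_eq']
  simp

/-- `c_1 = 2` on `ℤ²` (agreeing with the certified value of `SAWPulledLargeForceExpansionCoefficients.lean`, here without certificates).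
[cite: JansevanRensburgWhittington2013, §3.2 Theorem 8 (arXiv v4 p. 11)] -/
theorem largeForceCoeff_one_eq_two : largeForceCoeff 1 = 2 := by
  rw [← largeForceCoeffZd_one 1, largeForceCoeffZd_at_one]; rfl

/-! ### The cost-two irreducible bridges of `ℤ^{d+1}`: `(0, e₀, e₀ + v, e₀ + v + w)`, `w ≠ −v` transverse -/

/-- Reversing the sign of the transverse step negates it. [cite: MadrasSlade1993, Definition 1.2.4] -/
theorem twoStepV_not (d : ℕ) (j : Fin d) (b : Bool) : twoStepV d (j, !b) = -twoStepV d (j, b) := by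
  cases b <;> simp [twoStepV, Pi.single_neg]

/-- `twoStepV` is injective. [cite: MadrasSlade1993, Definition 1.2.4] -/
theorem twoStepV_injective (d : ℕ) : Function.Injective (twoStepV d) := by
  rintro ⟨j, b⟩ ⟨j', b'⟩ h2
  rw [twoStepV, twoStepV] at h2
  have hj : j = j' := by
    by_contra hne
    have hc := congrFun h2 j.succ
    rw [Pi.single_eq_same, Pi.single_eq_of_ne (fun h' => hne (Fin.succ_injective _ h'))] at hc
    cases b <;> simp at hc
  subst hj
  have hc := congrFun h2 j.succ
  rw [Pi.single_eq_same, Pi.single_eq_same] at hc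
  have hb : b = b' := by
    rcases b with _ | _ <;> rcases b' with _ | _ <;> simp_all
  rw [hb]

/-- `v + w = 0` for transverse steps forces `w = −v`, i.e. the reversed index. [cite: MadrasSlade1993, Definition 1.2.4] -/
theorem twoStepV_add_eq_zero (d : ℕ) {a b : Fin d × Bool} (h : twoStepV d a + twoStepV d b = 0) : b = (a.1, !a.2) := by
  have h' : twoStepV d b = twoStepV d (a.1, !a.2) := by
    rw [twoStepV_not]; exact eq_neg_of_add_eq_zero_right h
  exact twoStepV_injective d h'

/-- A transverse step is a lattice step: `x ∼ x + v`. [cite: MadrasSlade1993, Definition 1.2.4] -/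
theorem adj_add_twoStepV (d : ℕ) (x : Site (d + 1)) (s : Fin d × Bool) : (zdGraph (d + 1)).Adj x (x + twoStepV d s) := by
  rw [zdGraph_adj_iff]
  refine ⟨s.1.succ, ?_⟩
  rcases hb : s.2 with _ | _
  · right
    rw [twoStepV, hb, add_assoc, ← Pi.single_add]
    simp
  · left
    rw [twoStepV, hb]
    simp

/-- A lattice step that keeps the height is a transverse step. [cite: MadrasSlade1993, Definition 1.2.4] -/
theorem exists_twoStepV_of_adj (d : ℕ) {x z : Site (d + 1)} (ha : (zdGraph (d + 1)).Adj x z) (h0 : z 0 = x 0) :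
    ∃ s, z = x + twoStepV d s := by
  rw [zdGraph_adj_iff] at ha
  obtain ⟨i, hi⟩ := ha
  have hi0 : i ≠ 0 := by
    rintro rfl
    rcases hi with hi | hi
    · have hc := congrFun hi 0
      simp only [Pi.add_apply, Pi.single_eq_same] at hc
      omega
    · have hc := congrFun hi 0
      simp only [Pi.add_apply, Pi.single_eq_same] at hc
      omega
  obtain ⟨j, rfl⟩ := Fin.exists_succ_eq.2 hi0
  rcases hi with hi | hi
  · exact ⟨(j, true), by rw [twoStepV]; simpa using hi⟩
  · refine ⟨(j, false), ?_⟩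
    rw [twoStepV]
    simp only [Bool.false_eq_true, ↓reduceIte]
    have : z = x - Pi.single j.succ 1 := by rw [hi]; simp
    rw [this, sub_eq_add_neg, ← Pi.single_neg]

/-- A lattice step that raises the height is `+e₀`. [cite: MadrasSlade1993, Definition 1.2.4] -/
theorem eq_add_e0_of_adj (d : ℕ) {x z : Site (d + 1)} (ha : (zdGraph (d + 1)).Adj x z) (h0 : z 0 = x 0 + 1) :
    z = x + Pi.single 0 1 := by
  rw [zdGraph_adj_iff] at ha
  obtain ⟨i, hi | hi⟩ := ha
  · by_cases hi0 : i = 0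
    · subst hi0; exact hi
    · have hc := congrFun hi 0
      rw [Pi.add_apply, Pi.single_eq_of_ne (Ne.symm hi0)] at hc
      omega
  · have hc := congrFun hi 0
    rw [Pi.add_apply] at hc
    by_cases hi0 : i = 0
    · subst hi0; rw [Pi.single_eq_same] at hc; omega
    · rw [Pi.single_eq_of_ne (Ne.symm hi0)] at hc; omega

/-- A lattice step that lowers the height is `−e₀`. [cite: MadrasSlade1993, Definition 1.2.4] -/
theorem eq_sub_e0_of_adj (d : ℕ) {x z : Site (d + 1)} (ha : (zdGraph (d + 1)).Adj x z) (h0 : z 0 = x 0 - 1) :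
    z = x - Pi.single 0 1 := by
  rw [zdGraph_adj_iff] at ha
  obtain ⟨i, hi | hi⟩ := ha
  · have hc := congrFun hi 0
    rw [Pi.add_apply] at hc
    by_cases hi0 : i = 0
    · subst hi0; rw [Pi.single_eq_same] at hc; omega
    · rw [Pi.single_eq_of_ne (Ne.symm hi0)] at hc; omega
  · by_cases hi0 : i = 0
    · subst hi0; rw [hi]; simp
    · have hc := congrFun hi 0
      rw [Pi.add_apply, Pi.single_eq_of_ne (Ne.symm hi0)] at hc
      omega

/-- The first step of a bridge from the origin is `+e₀`. [cite: MadrasSlade1993, Definition 1.2.4] -/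
theorem apply_one_eq_e0_of_mem_bridges (d : ℕ) {n : ℕ} (hn : 1 ≤ n) {ω : ℕ → Site (d + 1)} (hω : ω ∈ bridges (d + 1) n) :
    ω 1 = Pi.single 0 1 := by
  obtain ⟨hωs, hb⟩ := mem_bridges.1 hω
  obtain ⟨h0, -, hadj, -⟩ := mem_saws.1 hωs
  have h10 : 0 < ω 1 0 := by have := (hb 1 le_rfl hn).1; rwa [h0] at this
  have ha := hadj 0 (by omega)
  rw [zero_add, h0] at ha
  have h1 : |ω 1 0 - (0 : Site (d + 1)) 0| ≤ 1 := abs_sub_le_one_of_adj ha 0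
  simp only [Pi.zero_apply, sub_zero] at h1
  have h11 : ω 1 0 = (0 : Site (d + 1)) 0 + 1 := by
    simp only [Pi.zero_apply, zero_add]
    have := (abs_le.1 h1).2
    omega
  have := eq_add_e0_of_adj d ha h11
  simpa using this

/-- The index set of the cost-two irreducible bridges: pairs of transverse steps `(v, w)` with `w ≠ −v`.
[cite: MadrasSlade1993, §4.2, eq. (4.2.20)–(4.2.22) (p. 94, 2013 reprint)] -/
def threeStepIndex (d : ℕ) : Finset ((Fin d × Bool) × (Fin d × Bool)) :=
  Finset.univ.filter fun s => s.2 ≠ (s.1.1, !s.1.2)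

/-- `#threeStepIndex = 2d(2d − 1)`. [cite: MadrasSlade1993, §4.2, eq. (4.2.20)–(4.2.22) (p. 94, 2013 reprint)] -/
theorem card_threeStepIndex (d : ℕ) : (threeStepIndex d).card = 2 * d * (2 * d - 1) := by
  have htot : (Finset.univ : Finset ((Fin d × Bool) × (Fin d × Bool))).card = 2 * d * (2 * d) := by
    rw [Finset.card_univ, Fintype.card_prod, Fintype.card_prod, Fintype.card_fin, Fintype.card_bool]; ring
  have hneg : (Finset.univ.filter fun s : (Fin d × Bool) × (Fin d × Bool) => ¬ s.2 ≠ (s.1.1, !s.1.2)).card = 2 * d := by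
    have heq : (Finset.univ.filter fun s : (Fin d × Bool) × (Fin d × Bool) => ¬ s.2 ≠ (s.1.1, !s.1.2)) =
        Finset.univ.image fun a : Fin d × Bool => (a, (a.1, !a.2)) := by
      ext ⟨a, b⟩
      simp only [ne_eq, Decidable.not_not, Finset.mem_filter, Finset.mem_univ, true_and, Finset.mem_image, Prod.mk.injEq]
      constructor
      · intro h; exact ⟨a, rfl, h.symm⟩
      · rintro ⟨a', rfl, h⟩; exact h.symm
    rw [heq, Finset.card_image_of_injective _ (fun a a' h => (Prod.mk.inj h).1), Finset.card_univ, Fintype.card_prod,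
      Fintype.card_fin, Fintype.card_bool, mul_comm]
  have h := Finset.card_filter_add_card_filter_not (s := (Finset.univ : Finset ((Fin d × Bool) × (Fin d × Bool))))
    (fun s => s.2 ≠ (s.1.1, !s.1.2))
  rw [hneg, htot] at h
  have h' : (threeStepIndex d).card + 2 * d = 2 * d * (2 * d) := h
  rcases Nat.eq_zero_or_pos d with rfl | hd
  · simpa using h'
  · have : 2 * d * (2 * d) = 2 * d * (2 * d - 1) + 2 * d := by
      obtain ⟨e, he⟩ : ∃ e, 2 * d = e + 1 := ⟨2 * d - 1, by omega⟩
      rw [he]; simp; ring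
    omega

/-- The three-step walk `(0, e₀, e₀ + v, e₀ + v + w)`. [cite: MadrasSlade1993, Definition 1.2.4] -/
def threeStep (d : ℕ) (s : (Fin d × Bool) × (Fin d × Bool)) : ℕ → Site (d + 1) := fun i =>
  if i = 0 then 0 else if i = 1 then Pi.single 0 1 else if i = 2 then Pi.single 0 1 + twoStepV d s.1
  else Pi.single 0 1 + twoStepV d s.1 + twoStepV d s.2

/-- Value at `0`. [cite: MadrasSlade1993, Definition 1.2.4] -/
@[simp] theorem threeStep_zero (d : ℕ) (s) : threeStep d s 0 = 0 := by simp [threeStep]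

/-- Value at `1`. [cite: MadrasSlade1993, Definition 1.2.4] -/
@[simp] theorem threeStep_one (d : ℕ) (s) : threeStep d s 1 = Pi.single 0 1 := by simp [threeStep]

/-- Value at `2`. [cite: MadrasSlade1993, Definition 1.2.4] -/
@[simp] theorem threeStep_two (d : ℕ) (s) : threeStep d s 2 = Pi.single 0 1 + twoStepV d s.1 := by simp [threeStep]

/-- Value at `i ≥ 3`. [cite: MadrasSlade1993, Definition 1.2.4] -/
theorem threeStep_of_three_le (d : ℕ) (s) {i : ℕ} (hi : 3 ≤ i) :
    threeStep d s i = Pi.single 0 1 + twoStepV d s.1 + twoStepV d s.2 := by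
  have h0 : i ≠ 0 := by omega
  have h1 : i ≠ 1 := by omega
  have h2 : i ≠ 2 := by omega
  simp [threeStep, h0, h1, h2]

/-- Heights along `threeStep`: `0, 1, 1, 1, …`. [cite: MadrasSlade1993, Definition 1.2.4] -/
theorem threeStep_apply_zero (d : ℕ) (s) (i : ℕ) : threeStep d s i 0 = if i = 0 then 0 else 1 := by
  rcases Nat.lt_or_ge i 3 with hi | hi
  · interval_cases i <;> simp
  · rw [threeStep_of_three_le d s hi, if_neg (by omega)]
    simp

/-- `threeStep s`, `s ∈ threeStepIndex`, is a three-step self-avoiding walk. [cite: MadrasSlade1993, Definition 1.2.4] -/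
theorem threeStep_mem_saws (d : ℕ) {s} (hs : s ∈ threeStepIndex d) : threeStep d s ∈ saws (d + 1) 3 := by
  have hs' : s.2 ≠ (s.1.1, !s.1.2) := (Finset.mem_filter.1 hs).2
  refine mem_saws.2 ⟨threeStep_zero d s, fun i hi => ?_, fun i hi => ?_, ?_⟩
  · rw [threeStep_of_three_le d s hi, threeStep_of_three_le d s le_rfl]
  · interval_cases i
    · rw [threeStep_zero, zero_add, threeStep_one, zdGraph_adj_iff]
      exact ⟨0, Or.inl (by simp)⟩
    · rw [threeStep_one, threeStep_two]
      exact adj_add_twoStepV d _ _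
    · rw [threeStep_two, threeStep_of_three_le d s le_rfl]
      exact adj_add_twoStepV d _ _
  · have hne : ∀ i j : ℕ, i ≤ 3 → j ≤ 3 → i < j → threeStep d s i ≠ threeStep d s j := by
      intro i j hi hj hij h
      have hh := congrFun h 0
      rw [threeStep_apply_zero, threeStep_apply_zero] at hh
      have hi0 : i ≠ 0 := by rintro rfl; simp [show j ≠ 0 by omega] at hh
      -- `i, j ∈ {1, 2, 3}`, `i < j`
      have hij' : (i = 1 ∧ j = 2) ∨ (i = 1 ∧ j = 3) ∨ (i = 2 ∧ j = 3) := by omega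
      rcases hij' with ⟨rfl, rfl⟩ | ⟨rfl, rfl⟩ | ⟨rfl, rfl⟩
      · rw [threeStep_one, threeStep_two] at h
        exact twoStepV_ne_zero d s.1 (by simpa using h.symm)
      · rw [threeStep_one, threeStep_of_three_le d s le_rfl, add_assoc] at h
        exact hs' (twoStepV_add_eq_zero d (by simpa using h.symm))
      · rw [threeStep_two, threeStep_of_three_le d s le_rfl] at h
        exact twoStepV_ne_zero d s.2 (by simpa using h.symm)
    intro i hi j hj h
    simp only [Set.mem_setOf_eq] at hi hj
    rcases lt_trichotomy i j with hij | rfl | hij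
    · exact absurd h (hne i j hi hj hij)
    · rfl
    · exact absurd h.symm (hne j i hj hi hij)

/-- `threeStep s` is an irreducible bridge of cost two. [cite: DuminilCopinHammond2013, §2.2] -/
theorem threeStep_mem_filter (d : ℕ) {s} (hs : s ∈ threeStepIndex d) :
    threeStep d s ∈ (irreducibleBridges (d + 1) 3).filter fun ω => costZd d 3 ω = 2 := by
  have hb : IsBridge 3 (threeStep d s) := by
    intro i h1 h2
    rw [threeStep_apply_zero, threeStep_apply_zero, threeStep_apply_zero, if_pos rfl, if_neg (by omega), if_neg (by omega)]
    exact ⟨zero_lt_one, le_rfl⟩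
  refine Finset.mem_filter.2 ⟨mem_irreducibleBridges.2 ⟨mem_bridges.2 ⟨threeStep_mem_saws d hs, hb⟩,
    ⟨by norm_num, hb, fun k hk1 hk2 hren => ?_⟩⟩, ?_⟩
  · have h := (hren.2.2 1 le_rfl (by omega)).1
    simp only [add_zero, threeStep_apply_zero] at h
    have hk0 : k ≠ 0 := by omega
    have hk1' : k + 1 ≠ 0 := by omega
    rw [if_neg hk0, if_neg hk1'] at h
    exact lt_irrefl _ h
  · simp [costZd, threeStep_apply_zero]

/-- Every cost-two irreducible bridge of length three is a `threeStep`. [cite: MadrasSlade1993, Definition 1.2.4] -/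
theorem eq_threeStep_of_mem (d : ℕ) {ω : ℕ → Site (d + 1)}
    (hω : ω ∈ (irreducibleBridges (d + 1) 3).filter fun ω => costZd d 3 ω = 2) : ∃ s ∈ threeStepIndex d, ω = threeStep d s := by
  obtain ⟨hirr, hcost⟩ := Finset.mem_filter.1 hω
  obtain ⟨hbr, -⟩ := mem_irreducibleBridges.1 hirr
  obtain ⟨hωs, hb⟩ := mem_bridges.1 hbr
  obtain ⟨h0, hend, hadj, hinj⟩ := mem_saws.1 hωs
  have hω1 : ω 1 = Pi.single 0 1 := apply_one_eq_e0_of_mem_bridges d (by norm_num) hbr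
  have h3eq : ω 3 0 = 1 := by
    have hc : costZd d 3 ω = 2 := hcost
    simp only [costZd] at hc
    have := (span_le_and_cost_bound_zd hirr).1
    have h30 : 0 < ω 3 0 := by have := (hb 3 (by norm_num) le_rfl).1; rwa [h0] at this
    omega
  have h2eq : ω 2 0 = 1 := by
    have h := hb 2 (by norm_num) (by norm_num)
    rw [h0, h3eq] at h
    simp only [Pi.zero_apply] at h
    omega
  have h1eq : ω 1 0 = 1 := by rw [hω1]; simp
  obtain ⟨a, ha⟩ := exists_twoStepV_of_adj d (hadj 1 (by norm_num)) (by rw [h2eq, h1eq])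
  obtain ⟨b, hb'⟩ := exists_twoStepV_of_adj d (hadj 2 (by norm_num)) (by rw [h3eq, h2eq])
  have hab : b ≠ (a.1, !a.2) := by
    intro hba
    have h13 : ω 3 = ω 1 := by
      rw [hb', ha, hba, twoStepV_not, add_assoc, add_neg_cancel, add_zero]
    have := hinj (show (3 : ℕ) ∈ {i | i ≤ 3} by simp) (show (1 : ℕ) ∈ {i | i ≤ 3} by simp) h13
    omega
  refine ⟨(a, b), Finset.mem_filter.2 ⟨Finset.mem_univ _, hab⟩, funext fun i => ?_⟩
  rcases Nat.lt_or_ge i 3 with hi3 | hi3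
  · interval_cases i
    · rw [h0, threeStep_zero]
    · rw [hω1, threeStep_one]
    · rw [ha, hω1, threeStep_two]
  · rw [hend i hi3, hb', ha, hω1, threeStep_of_three_le d _ hi3]

/-- `threeStep` is injective. [cite: MadrasSlade1993, Definition 1.2.4] -/
theorem threeStep_injective (d : ℕ) : Function.Injective (threeStep d) := by
  rintro ⟨a, b⟩ ⟨a', b'⟩ h
  have h2 := congrFun h 2
  rw [threeStep_two, threeStep_two, add_right_inj] at h2
  have ha : a = a' := twoStepV_injective d h2
  have h3 := congrFun h 3
  rw [threeStep_of_three_le d _ le_rfl, threeStep_of_three_le d _ le_rfl, ha, add_right_inj] at h3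
  have hb : b = b' := twoStepV_injective d h3
  rw [ha, hb]

/-- ★ The cost-two irreducible bridges of length three are exactly the `2d(2d−1)` walks `(0, e₀, e₀ + v, e₀ + v + w)`, `w ≠ −v`.
[cite: MadrasSlade1993, §4.2, eq. (4.2.20)–(4.2.22) (p. 94, 2013 reprint)] -/
theorem filter_costZd_two_three_eq_image (d : ℕ) [DecidableEq (ℕ → Site (d + 1))] :
    ((irreducibleBridges (d + 1) 3).filter fun ω => costZd d 3 ω = 2) = (threeStepIndex d).image (threeStep d) := by
  ext ω
  constructor
  · intro h
    obtain ⟨s, hs, rfl⟩ := eq_threeStep_of_mem d h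
    exact Finset.mem_image_of_mem _ hs
  · intro h
    obtain ⟨s, hs, rfl⟩ := Finset.mem_image.1 h
    exact threeStep_mem_filter d hs

/-- ★ **`N_{2,3} = 2d(2d − 1)`** on `ℤ^{d+1}`. [cite: MadrasSlade1993, §4.2, eq. (4.2.20)–(4.2.22) (p. 94, 2013 reprint)] -/
theorem costCoeffZd_two_three (d : ℕ) : costCoeffZd d 2 3 = 2 * d * (2 * d - 1) := by
  classical
  rw [costCoeffZd, filter_costZd_two_three_eq_image, Finset.card_image_of_injective _ (threeStep_injective d),
    card_threeStepIndex]

/-- **No cost-two irreducible bridge has length four**: with heights `0, 1, h₂, h₃, 2` either some `k ∈ {1, 2, 3}` is a renewal time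
(`(h₂, h₃) = (2, 2), (1, 2), (1, 1)`) or the walk revisits a site (`(h₂, h₃) = (2, 1)`: steps `+e₀, −e₀`).
[cite: DuminilCopinHammond2013, §2.2] -/
theorem costCoeffZd_two_four (d : ℕ) : costCoeffZd d 2 4 = 0 := by
  rw [costCoeffZd, Finset.card_eq_zero, Finset.filter_eq_empty_iff]
  intro ω hirr hcost
  obtain ⟨hbr, hI⟩ := mem_irreducibleBridges.1 hirr
  obtain ⟨hωs, hb⟩ := mem_bridges.1 hbr
  obtain ⟨h0, -, hadj, hinj⟩ := mem_saws.1 hωs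
  have hω1 : ω 1 = Pi.single 0 1 := apply_one_eq_e0_of_mem_bridges d (by norm_num) hbr
  have h1 : ω 1 0 = 1 := by rw [hω1]; simp
  have h4 : ω 4 0 = 2 := by
    simp only [costZd] at hcost
    have := (span_le_and_cost_bound_zd hirr).1
    have h40 : 0 < ω 4 0 := by have := (hb 4 (by norm_num) le_rfl).1; rwa [h0] at this
    omega
  have hb2 := hb 2 (by norm_num) (by norm_num)
  have hb3 := hb 3 (by norm_num) (by norm_num)
  rw [h0, h4] at hb2 hb3
  simp only [Pi.zero_apply] at hb2 hb3
  have hd12 : |ω 2 0 - ω 1 0| ≤ 1 := abs_sub_le_one_of_adj (hadj 1 (by norm_num)) 0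
  have hd23 : |ω 3 0 - ω 2 0| ≤ 1 := abs_sub_le_one_of_adj (hadj 2 (by norm_num)) 0
  have hnoren := hI.2.2
  -- a renewal time `k` with all the bridge inequalities read off the heights
  have hren : ∀ k, 1 ≤ k → k ≤ 3 → (∀ i, 1 ≤ i → i ≤ k → 0 < ω i 0 ∧ ω i 0 ≤ ω k 0) →
      (∀ i, 1 ≤ i → i ≤ 4 - k → ω k 0 < ω (k + i) 0 ∧ ω (k + i) 0 ≤ ω 4 0) → False := by
    intro k hk1 hk3 hpre hsuf
    refine hnoren k hk1 (by omega) ⟨by omega, fun i hi1 hi2 => ?_, fun i hi1 hi2 => ?_⟩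
    · rw [h0]; exact hpre i hi1 hi2
    · have := hsuf i hi1 hi2
      simp only [add_zero]
      rwa [show k + (4 - k) = 4 by omega]
  have h2cases : ω 2 0 = 1 ∨ ω 2 0 = 2 := by omega
  have h3cases : ω 3 0 = 1 ∨ ω 3 0 = 2 := by omega
  rcases h2cases with h2 | h2 <;> rcases h3cases with h3 | h3
  · -- (1,1): renewal at 3
    refine hren 3 (by norm_num) le_rfl (fun i hi1 hi2 => ?_) (fun i hi1 hi2 => ?_)
    · interval_cases i <;> simp [h1, h2, h3]
    · obtain rfl : i = 1 := by omega
      simp [h3, h4]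
  · -- (1,2): renewal at 2
    refine hren 2 (by norm_num) (by norm_num) (fun i hi1 hi2 => ?_) (fun i hi1 hi2 => ?_)
    · interval_cases i <;> simp [h1, h2]
    · interval_cases i <;> simp [h2, h3, h4]
  · -- (2,1): the steps `1 → 2 → 3` are `+e₀, −e₀`: the walk revisits `ω 1`
    have h12 : ω 2 = ω 1 + Pi.single 0 1 := eq_add_e0_of_adj d (hadj 1 (by norm_num)) (by rw [h2, h1]; norm_num)
    have h23 : ω 3 = ω 2 - Pi.single 0 1 := eq_sub_e0_of_adj d (hadj 2 (by norm_num)) (by rw [h3, h2]; norm_num)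
    have h13 : ω 3 = ω 1 := by rw [h23, h12, add_sub_cancel_right]
    have := hinj (show (3 : ℕ) ∈ {i | i ≤ 4} by simp) (show (1 : ℕ) ∈ {i | i ≤ 4} by simp) h13
    omega
  · -- (2,2): renewal at 1
    refine hren 1 le_rfl (by norm_num) (fun i hi1 hi2 => ?_) (fun i hi1 hi2 => ?_)
    · obtain rfl : i = 1 := by omega
      simp [h1]
    · interval_cases i <;> simp [h1, h2, h3, h4]

/-- A bridge of positive length ends at positive height, so its cost is `< n`: `N_{c,n} = 0` for `n ≤ c`, `1 ≤ n`… here `N_{2,2} = 0`.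
[cite: MadrasSlade1993, §4.2, eq. (4.2.20)–(4.2.22) (p. 94, 2013 reprint)] -/
theorem costCoeffZd_two_two (d : ℕ) : costCoeffZd d 2 2 = 0 := by
  rw [costCoeffZd, Finset.card_eq_zero, Finset.filter_eq_empty_iff]
  intro ω hirr hcost
  obtain ⟨hbr, -⟩ := mem_irreducibleBridges.1 hirr
  obtain ⟨hωs, hb⟩ := mem_bridges.1 hbr
  have h0 := (mem_saws.1 hωs).1
  have h20 : 0 < ω 2 0 := by have := (hb 2 (by norm_num) le_rfl).1; rwa [h0] at this
  simp only [costZd] at hcost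
  omega

/-- ★ **`N_{2,n}`** on `ℤ^{d+1}`: `2d(2d−1)` at `n = 3`, zero otherwise. [cite: MadrasSlade1993, §4.2, eq. (4.2.20)–(4.2.22) (p. 94, 2013 reprint)] -/
theorem costCoeffZd_two (d n : ℕ) : costCoeffZd d 2 n = if n = 3 then 2 * d * (2 * d - 1) else 0 := by
  by_cases hn : n = 3
  · subst hn; rw [if_pos rfl, costCoeffZd_two_three]
  rw [if_neg hn]
  rcases Nat.lt_or_ge n 5 with h | h
  · interval_cases n
    · exact costCoeffZd_eq_zero_of_lt' (by norm_num)
    · exact costCoeffZd_eq_zero_of_lt' (by norm_num)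
    · exact costCoeffZd_two_two d
    · exact absurd rfl hn
    · exact costCoeffZd_two_four d
  · exact costCoeffZd_eq_zero_of_lt (by omega)

/-- ★★ **THE SECOND-ORDER COEFFICIENT: `c^{(d)}_2 = −2d`** on `ℤ^{d+1}` (`e_2 = P_2(1) + P_1(1)² − P_1(1)P_1'(1) = 2d(2d−1) + 4d² − 2d·4d`).
[cite: JansevanRensburgWhittington2013, §3.2 Theorem 8 (arXiv v4 p. 11)] -/
theorem largeForceCoeffZd_at_two (d : ℕ) : largeForceCoeffZd d 2 = -(2 * (d : ℤ)) := by
  show CostSeries.e (costCoeffZd d) 2 = _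
  rw [CostSeries.e_two]
  have hS1 : ∑ n ∈ Finset.range 4, ((costCoeffZd d 1 n : ℕ) : ℤ) = 2 * d := by
    simp only [Finset.sum_range_succ, Finset.sum_range_zero, costCoeffZd_one_two,
      costCoeffZd_one_of_ne_two d (show (0:ℕ) ≠ 2 by norm_num), costCoeffZd_one_of_ne_two d (show (1:ℕ) ≠ 2 by norm_num),
      costCoeffZd_one_of_ne_two d (show (3:ℕ) ≠ 2 by norm_num)]
    push_cast; ring
  have hD1 : ∑ n ∈ Finset.range 4, ((n : ℤ) * (costCoeffZd d 1 n : ℕ)) = 4 * d := by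
    simp only [Finset.sum_range_succ, Finset.sum_range_zero, costCoeffZd_one_two,
      costCoeffZd_one_of_ne_two d (show (0:ℕ) ≠ 2 by norm_num), costCoeffZd_one_of_ne_two d (show (1:ℕ) ≠ 2 by norm_num),
      costCoeffZd_one_of_ne_two d (show (3:ℕ) ≠ 2 by norm_num)]
    push_cast; ring
  have hS2 : ∑ n ∈ Finset.range 6, ((costCoeffZd d 2 n : ℕ) : ℤ) = 2 * d * (2 * d - 1) := by
    simp only [Finset.sum_range_succ, Finset.sum_range_zero, costCoeffZd_two]
    rcases Nat.eq_zero_or_pos d with rfl | hd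
    · simp
    · obtain ⟨e, he⟩ : ∃ e, d = e + 1 := ⟨d - 1, by omega⟩
      subst he
      push_cast
      simp only [show 2 * (e + 1) - 1 = 2 * e + 1 by omega]
      push_cast; ring
  rw [hS1, hD1, hS2]
  ring

/-- `c_2 = −2` on `ℤ²` (agreeing with the certified value, here without certificates). [cite: JansevanRensburgWhittington2013, §3.2 Theorem 8 (arXiv v4 p. 11)] -/
theorem largeForceCoeff_two_eq_neg_two : largeForceCoeff 2 = -2 := by
  rw [← largeForceCoeffZd_one 2, largeForceCoeffZd_at_two]; rfl

/-! ### The expansion to every order with an explicit tail, every dimension -/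

/-- ★★ **The large-force expansion on `ℤ^{d+1}` to every order `K`, with remainder `O(y^{-K})`**:
`|e^{λ_B(y)} − Σ_{k ≤ K} c^{(d)}_k y^{1−k}| ≤ C / y^K` for `y ≥ y₁` (from the convergent series and the coefficient bound
`|c^{(d)}_k| ≤ 3 R^k`). [cite: JansevanRensburgWhittington2013, §3.2 Theorem 8 (arXiv v4 p. 11)] -/
theorem exp_pulledBridgeFreeEnergy_expansion_zd (d K : ℕ) :
    ∃ C y₁ : ℝ, 0 < y₁ ∧ ∀ y ≥ y₁, |Real.exp (pulledBridgeFreeEnergy (d + 1) y) -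
      ∑ k ∈ Finset.range (K + 1), y * ((largeForceCoeffZd d k : ℝ) * y⁻¹ ^ k)| ≤ C / y ^ K := by
  -- coefficient bound `|e_k| ≤ 3 R^k`, `R = 48 ρ (B+1)`, `B = 2κ`, `ρ = 2κ²`
  obtain ⟨R, hR1, he⟩ : ∃ R : ℝ, 1 ≤ R ∧ ∀ k, |((largeForceCoeffZd d k : ℤ) : ℝ)| ≤ 3 * R ^ k := by
    have hκ : 1 ≤ kappaZd d := by unfold kappaZd; exact_mod_cast one_le_count (d + 1) 1
    refine ⟨3 * (16 * (2 * kappaZd d ^ 2) * (2 * kappaZd d + 1)), by nlinarith, fun k => ?_⟩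
    have h := CostSeries.abs_e_le (costCoeffZd d) (B := 2 * kappaZd d) (ρ := 2 * kappaZd d ^ 2) (by positivity) (by positivity)
      (sum_costCoeffZd_le d) k
    have h3 : (3 : ℝ) ^ (k + 1) * (16 * (2 * kappaZd d ^ 2) * (2 * kappaZd d + 1)) ^ k =
        3 * (3 * (16 * (2 * kappaZd d ^ 2) * (2 * kappaZd d + 1))) ^ k := by
      rw [mul_pow (3 : ℝ) (16 * (2 * kappaZd d ^ 2) * (2 * kappaZd d + 1)) k, pow_succ]; ring
    calc |((largeForceCoeffZd d k : ℤ) : ℝ)| = |((CostSeries.e (costCoeffZd d) k : ℤ) : ℝ)| := rfl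
      _ ≤ 3 ^ (k + 1) * (16 * (2 * kappaZd d ^ 2) * (2 * kappaZd d + 1)) ^ k := h
      _ = _ := h3
  have hR0 : 0 < R := by linarith
  refine ⟨6 * R ^ (K + 1), max (tStarZd d)⁻¹ (2 * R), lt_max_of_lt_left (inv_pos.2 (tStarZd_pos d)), fun y hy => ?_⟩
  have hyt : (tStarZd d)⁻¹ ≤ y := le_trans (le_max_left _ _) hy
  have hyR : 2 * R ≤ y := le_trans (le_max_right _ _) hy
  have hy0 : 0 < y := lt_of_lt_of_le (by linarith) hyR
  have hq : R / y ≤ 1 / 2 := by rw [div_le_iff₀ hy0]; linarith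
  have hq0 : 0 ≤ R / y := by positivity
  have hsum := hasSum_largeForceCoeffZd d hyt
  set f : ℕ → ℝ := fun k => y * ((largeForceCoeffZd d k : ℝ) * y⁻¹ ^ k) with hf
  -- split off the first `K + 1` terms
  have hsplit := hsum.summable.sum_add_tsum_nat_add (K + 1)
  rw [hsum.tsum_eq] at hsplit
  -- the tail is dominated by a geometric series
  have hg : ∀ k, |f (k + (K + 1))| ≤ 3 * R ^ (K + 1) / y ^ K * (R / y) ^ k := by
    intro k
    have h1 : |f (k + (K + 1))| = y * (|((largeForceCoeffZd d (k + (K + 1)) : ℤ) : ℝ)| * y⁻¹ ^ (k + (K + 1))) := by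
      rw [hf]; simp only
      rw [abs_mul, abs_of_pos hy0, abs_mul, abs_pow, abs_inv, abs_of_pos hy0]
    rw [h1]
    calc y * (|((largeForceCoeffZd d (k + (K + 1)) : ℤ) : ℝ)| * y⁻¹ ^ (k + (K + 1)))
        ≤ y * (3 * R ^ (k + (K + 1)) * y⁻¹ ^ (k + (K + 1))) := by gcongr; exact he _
      _ = 3 * R ^ (K + 1) / y ^ K * (R / y) ^ k := by
          have hy' : y ≠ 0 := hy0.ne'
          rw [div_pow, inv_pow, pow_add y, pow_succ y K, pow_add R]
          field_simp
  have hgs : Summable fun k => 3 * R ^ (K + 1) / y ^ K * (R / y) ^ k :=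
    (summable_geometric_of_lt_one hq0 (by linarith)).mul_left _
  have htail_s : Summable fun k => |f (k + (K + 1))| :=
    Summable.of_nonneg_of_le (fun k => abs_nonneg _) hg hgs
  have htail : |∑' k, f (k + (K + 1))| ≤ 6 * R ^ (K + 1) / y ^ K := by
    have h1 : |∑' k, f (k + (K + 1))| ≤ ∑' k, |f (k + (K + 1))| := by
      have := norm_tsum_le_tsum_norm (f := fun k => f (k + (K + 1))) (by simpa [Real.norm_eq_abs] using htail_s)
      simpa [Real.norm_eq_abs] using this
    have h2 : ∑' k, |f (k + (K + 1))| ≤ ∑' k, 3 * R ^ (K + 1) / y ^ K * (R / y) ^ k := htail_s.tsum_le_tsum hg hgs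
    have h3 : ∑' k : ℕ, 3 * R ^ (K + 1) / y ^ K * (R / y) ^ k = 3 * R ^ (K + 1) / y ^ K * (1 - R / y)⁻¹ := by
      rw [tsum_mul_left, tsum_geometric_of_lt_one hq0 (by linarith)]
    have h4 : 3 * R ^ (K + 1) / y ^ K * (1 - R / y)⁻¹ ≤ 6 * R ^ (K + 1) / y ^ K := by
      have h5 : (1 - R / y)⁻¹ ≤ 2 := by
        rw [inv_le_comm₀ (by linarith) (by norm_num)]; linarith
      calc 3 * R ^ (K + 1) / y ^ K * (1 - R / y)⁻¹ ≤ 3 * R ^ (K + 1) / y ^ K * 2 := by gcongr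
        _ = 6 * R ^ (K + 1) / y ^ K := by ring
    linarith
  have hmain : Real.exp (pulledBridgeFreeEnergy (d + 1) y) - ∑ k ∈ Finset.range (K + 1), f k = ∑' k, f (k + (K + 1)) := by
    rw [← hsplit]; ring
  rw [hmain]
  exact htail

/-- ★★ **`e^{λ_B(y)} = y + 2d + O(1/y)` on `ℤ^{d+1}`, every dimension**: there are `C` and `y₁` with
`|e^{λ_B(y)} − (y + 2d)| ≤ C / y` for all `y ≥ y₁`. [cite: JansevanRensburgWhittington2013, §3.2 Theorem 8 (arXiv v4 p. 11)] -/
theorem exp_pulledBridgeFreeEnergy_first_order_zd (d : ℕ) :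
    ∃ C y₁ : ℝ, 0 < y₁ ∧ ∀ y ≥ y₁, |Real.exp (pulledBridgeFreeEnergy (d + 1) y) - (y + 2 * d)| ≤ C / y := by
  obtain ⟨C, y₁, hy₁, h⟩ := exp_pulledBridgeFreeEnergy_expansion_zd d 1
  refine ⟨C, y₁, hy₁, fun y hy => ?_⟩
  have hy0 : 0 < y := lt_of_lt_of_le hy₁ hy
  have h1 := h y hy
  have hs : ∑ k ∈ Finset.range (1 + 1), y * ((largeForceCoeffZd d k : ℝ) * y⁻¹ ^ k) = y + 2 * d := by
    rw [Finset.sum_range_succ, Finset.sum_range_one, largeForceCoeffZd_zero, largeForceCoeffZd_at_one]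
    push_cast
    field_simp
  rwa [hs, pow_one] at h1

/-- ★★ **`e^{λ_B(y)} = y + 2d − 2d/y + O(1/y²)` on `ℤ^{d+1}`, every dimension.** [cite: JansevanRensburgWhittington2013, §3.2 Theorem 8 (arXiv v4 p. 11)] -/
theorem exp_pulledBridgeFreeEnergy_second_order_zd (d : ℕ) :
    ∃ C y₁ : ℝ, 0 < y₁ ∧ ∀ y ≥ y₁, |Real.exp (pulledBridgeFreeEnergy (d + 1) y) - (y + 2 * d - 2 * d / y)| ≤ C / y ^ 2 := by
  obtain ⟨C, y₁, hy₁, h⟩ := exp_pulledBridgeFreeEnergy_expansion_zd d 2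
  refine ⟨C, y₁, hy₁, fun y hy => ?_⟩
  have hy0 : 0 < y := lt_of_lt_of_le hy₁ hy
  have h1 := h y hy
  have hs : ∑ k ∈ Finset.range (2 + 1), y * ((largeForceCoeffZd d k : ℝ) * y⁻¹ ^ k) = y + 2 * d - 2 * d / y := by
    rw [Finset.sum_range_succ, Finset.sum_range_succ, Finset.sum_range_one, largeForceCoeffZd_zero, largeForceCoeffZd_at_one,
      largeForceCoeffZd_at_two]
    push_cast
    field_simp
    ring
  rwa [hs] at h1

/-- ★ **`e^{λ_B(y)} − y → 2d`** as `y → ∞`, on `ℤ^{d+1}`. [cite: JansevanRensburgWhittington2013, §3.2 Theorem 8 (arXiv v4 p. 11)] -/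
theorem tendsto_exp_pulledBridgeFreeEnergy_sub_zd (d : ℕ) :
    Tendsto (fun y => Real.exp (pulledBridgeFreeEnergy (d + 1) y) - y) atTop (𝓝 (2 * d)) := by
  obtain ⟨C, y₁, hy₁, h⟩ := exp_pulledBridgeFreeEnergy_first_order_zd d
  have hC : 0 ≤ C := by
    have := h y₁ le_rfl
    have h0 : 0 ≤ C / y₁ := (abs_nonneg _).trans this
    exact (div_nonneg_iff.1 h0).elim (fun h => h.1) fun h => absurd h.2 (not_le.2 hy₁)
  rw [Metric.tendsto_atTop]
  intro ε hε
  refine ⟨max y₁ (C / ε + 1), fun y hy => ?_⟩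
  have hy1 : y₁ ≤ y := le_trans (le_max_left _ _) hy
  have hy2 : C / ε + 1 ≤ y := le_trans (le_max_right _ _) hy
  have hy0 : 0 < y := lt_of_lt_of_le hy₁ hy1
  rw [Real.dist_eq]
  calc |Real.exp (pulledBridgeFreeEnergy (d + 1) y) - y - 2 * d|
      = |Real.exp (pulledBridgeFreeEnergy (d + 1) y) - (y + 2 * d)| := by ring_nf
    _ ≤ C / y := h y hy1
    _ < ε := by
        rw [div_lt_iff₀ hy0]
        have : C / ε < y := by linarith
        rw [div_lt_iff₀ hε] at this
        linarith

end Literature.Probability.RandomPlanarGeometry.SAW.Zd
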